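import Summits.QuantumFields.BalabanUV.Beta.MeanValueBinderAdapter
import Summits.QuantumFields.BalabanUV.Beta.SubsolutionMeanValueBox

/-!
# `Summit.QuantumFields.BalabanUV.Beta.MultiscaleRegularityClosed` — engine file 17: O.2 ITEM (ii-b) CLOSED AT MODEL LEVEL —
# file 9b's local-regularity datum `hreg` for `levelOp` and the SUP MEMBER (3.42)₁'s SHAPE
# `|((levelOp)⁻¹u)(x,i)| ≤ B·n(x)²·e^{−(κ − (1+d/2)log L/R)·d_n(x,t_{k′})}·max|u|`, sitewise and level-free, WITH NO BINDER LEFT: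
# the ℓ² mean-value binder (MV₂) of file 16d is DISCHARGED by co-owner beta-d4-p2's kernel theorem
# `SubsolutionMeanValueBox.meanValue_ball` (lattice De Giorgi: Faber–Krahn, Caccioppoli, iteration — «LATTICE-DEGIORGI-MV», gen 10)
# through a radius-shrinking adapter (room `10R + 4 ≤ N_μ` ⟶ `2r + 2 ≤ N_μ`)

HONEST FRAMING (page 1 of everything in this cell).  Discharging `FlowStep.BetaPertH` would make Bałaban's ultraviolet
stability UNCONDITIONAL — a constructive-QFT result; it is NOT the continuum limit and NOT the Clay problem.  This module
discharges nothing of `BetaPertH`; it is [folklore] finite-dimensional bookkeeping about the MODEL operator, kernel-checked, by the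
OWNER of binder row D4 (unit `b2b-balaban-beta-an4`, gen 45), composing co-owner beta-d4-p2's theorem with files 16d∕16e.  HONEST
DEPENDENCY: continuum YM on T⁴ ⇐ BetaPertH ∧ nine spine estimates (0/9 proved); BetaPertH ⇐ (D1) ∧ (D4) ∧ CAP+tail; G-an2-4
gates asym, D1 and NE2/3/4.

THE POINT (census event for NODE O.2, NOT for the critical path).  Gen 44 isolated `hreg` — discrete interior regularity at every
scale for the multi-region averaged operator `levelOp = D*D + Σ_l a_l G_lᵀG_l` — as THE single shared analytic residual of row D4's
MODEL programme (E-an4-141a); gen 45 derived it from ONE classical binder on the free Laplacian (files 15a–16e, with beta-d4-p3's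
reduction `SubsolutionMeanValue`); beta-d4-p2 proved that binder in the kernel for constant weights on torus boxes
(`SubsolutionMeanValueBox.meanValue_ball`: `R ≥ 1`, `10R + 4 ≤ N_μ`, `z ≥ 0`, `W·z ≤ Nz` on `dist(·,x₀) ≤ R` ⟹
`z(x₀) ≤ C_d·√((Σ_{dist ≤ R} z²)/R^d)`, `C_d = 2^d/√θ_d` — d ONLY).  THIS FILE composes: **`hMV2_holds`** = 16d's binder (MV₂) for EVERY
radius with `2r + 2 ≤ N_μ`, constant `max(√(11^d), C_d·√(21^d))`, by radius shrinking `R = ⌊(r−1)/5⌋` (`10R + 4 ≤ 2r + 2`,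
`2r + 1 ≤ 21R`) and the trivial case `r ≤ 5`; hence **`hreg_holds`** (9b's datum for `levelOp`, `ρ₀ = 4d+1`, HYPOTHESIS-FREE in the
MODEL setting with a constant bond weight, the additive grading and the (P) budget) and **`real_sup_levelOp_inverse_le`** (9b's
sup member BY NAME, HYPOTHESIS-FREE beyond the MODEL setting of `MultiscaleDecay.hc_levelOp`: coercivity `hcoer`, `|c_b| ≤ c_max`,
`κ ≤ 1`, the Combes–Thomas margin `hμ`, the rate condition).  So O.2 item (ii-b) is CLOSED AT MODEL LEVEL: the members (3.46)₁,
(3.42)₄, (3.42)₁ and — via file 13 — (3.47)₁ of [B9] Thm 3.1∕(3.47) hold for the MODEL operator in the kernel with level-free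
constants.  WHAT THIS IS NOT: not a bound on Bałaban's G′(U) (nothing of print instantiated: U small-field, print's averaging profile,
the regions (2.1)–(2.2) and the norms (3.35) are the (I1)∕(I2) interface of NODE A.4 = (T3), the critical path, UNCHANGED); the
gradient∕Hölder members (O.2 item (i)) remain OPEN; row D4 readiness width 0; D4 DISCHARGE NO DATE.

WHAT IS CERTIFIED (kernel, 0 sorry, 0 def): `l2binder_of_roomy10` (generic adapter: room `10R+4`, `R ≥ 1`, `S/R^d` ⟶ 16d's shape),
**`hMV2_holds`**, **`hreg_holds`**, **`real_sup_levelOp_inverse_le`**.  LOCATORS (shape only; ABSOLUTE RULE — nothing printed is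
asserted): [Balaban1985BackgroundPropagators] Thm 3.1 (3.42) p. 397; [Balaban1984PropagatorsII] Prop. 2.2 (2.67) p. 234;
[Balaban1983RegularityDecay] Lemma 2.2 (2.17) pp. 577–578.  NOT BetaPertH, NOT continuum, NOT Clay, NOT summit progress.
-/

open scoped BigOperators
open Finset

namespace Summit.QuantumFields.BalabanUV.Beta.MultiscaleRegularityClosed

open Summit.QuantumFields.BalabanUV.Beta.BoxPoincare (Box)
open Summit.QuantumFields.BalabanUV.Beta.MultiscaleCoerciveTorus
open Summit.QuantumFields.BalabanUV.Beta.MultiscaleDistance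
open Summit.QuantumFields.BalabanUV.Beta.MultiscaleDecayBudget
open Summit.QuantumFields.BalabanUV.Beta.MultiscaleRegularityOfMeanValueL2 (hreg_of_meanValueL2
  real_sup_levelOp_inverse_le_of_meanValueL2)
open Summit.QuantumFields.BalabanUV.Beta.MeanValueBinderAdapter (wn_of_subharmonic single_le_sqrt_sum_sq)
open Summit.QuantumFields.BalabanUV.Beta.SubsolutionMeanValueBox (Cmv Cmv_pos meanValue_ball)
open Literature.MathematicalPhysics.QuantumFieldTheory.Balaban1983to89
open Literature.MathematicalPhysics.QuantumFieldTheory.Balaban1983to89.B9Thm37GluePU (bsrc btgt)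
open Literature.MathematicalPhysics.QuantumFieldTheory.Balaban1983to89.B9Thm37GlueTorusCov (tblk)
open Literature.MathematicalPhysics.QuantumFieldTheory.Balaban1983to89.B9Thm37GlueTorusCovLevels (levelOp)
open B5TorusCover (UT Ctr ctrU)
open B5Leibniz121 (up dn)

noncomputable section

variable {d : ℕ} {N : Fin d → ℕ} [∀ i, NeZero (N i)]

/-! ## §1 The adapter for room `10R + 4 ≤ N_μ` in the ℓ² currency -/

/-- **RADIUS SHRINKING (ℓ² form, room `10R + 4 ≤ N_μ`, `R ≥ 1`, normalisation `S/R^d` — the shape of beta-d4-p2's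
`SubsolutionMeanValueBox.meanValue_ball`).**  Such a binder (normalized sub-harmonicity hypothesis, constant `K ≥ 0`) implies file
16d's (MV₂) for every radius with `2r + 2 ≤ N_μ`, constant `max(√(11^d), K·√(21^d))`: `r ≤ 5` trivial (`z(x₀) ≤ √(Σ z²) ≤
√(11^d)·√((2r+1)^{−d}Σ z²)`); `r ≥ 6`: the binder at `R = ⌊(r−1)/5⌋ ≥ 1` (`10R + 4 ≤ 2r + 2`, `box_R ⊆ box_r`, `2r + 1 ≤ 21R`).
[folklore] -/
theorem l2binder_of_roomy10 [NeZero d] {K : ℝ} (hK : 0 ≤ K)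
    (h : ∀ (x₀ : UT N) (R : ℕ), 1 ≤ R → (∀ μ, 10 * R + 4 ≤ N μ) → ∀ z : UT N → ℝ, (∀ y, 0 ≤ z y) →
      (∀ x, dist x x₀ ≤ R → 2 * d * z x ≤ ∑ μ, (z (up x μ) + z (dn x μ))) →
      z x₀ ≤ K * Real.sqrt ((∑ x ∈ univ.filter (fun x : UT N => dist x x₀ ≤ R), z x ^ 2) / (R : ℝ) ^ d)) :
    ∀ (x₀ : UT N) (r : ℕ), (∀ μ, 2 * r + 2 ≤ N μ) → ∀ z : UT N → ℝ, (∀ y, 0 ≤ z y) →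
      (∀ x, dist x x₀ ≤ r → 2 * d * z x ≤ ∑ μ, (z (up x μ) + z (dn x μ))) →
      z x₀ ≤ max (Real.sqrt (11 ^ d)) (K * Real.sqrt (21 ^ d)) *
        Real.sqrt (((2 * r + 1 : ℝ) ^ d)⁻¹ * ∑ x ∈ univ.filter (fun x : UT N => dist x x₀ ≤ r), z x ^ 2) := by
  intro x₀ r hr z hz hsub
  set Bx := univ.filter (fun x : UT N => dist x x₀ ≤ r) with hBx
  set S := ∑ x ∈ Bx, z x ^ 2 with hS
  have hS0 : 0 ≤ S := Finset.sum_nonneg fun x _ => sq_nonneg _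
  have h2r : (0 : ℝ) < (2 * r + 1 : ℝ) ^ d := by positivity
  have hx₀ : x₀ ∈ Bx := by rw [hBx, mem_filter]; exact ⟨mem_univ _, by rw [dist_self]; positivity⟩
  have hsplit : Real.sqrt S = Real.sqrt ((2 * r + 1 : ℝ) ^ d) * Real.sqrt (((2 * r + 1 : ℝ) ^ d)⁻¹ * S) := by
    rw [← Real.sqrt_mul h2r.le, ← mul_assoc, mul_inv_cancel₀ h2r.ne', one_mul]
  have hnorm0 : 0 ≤ Real.sqrt (((2 * r + 1 : ℝ) ^ d)⁻¹ * S) := Real.sqrt_nonneg _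
  by_cases hsmall : r ≤ 5
  · have h11 : Real.sqrt ((2 * r + 1 : ℝ) ^ d) ≤ Real.sqrt (11 ^ d) := by
      refine Real.sqrt_le_sqrt (pow_le_pow_left₀ (by positivity) ?_ d)
      have : (r : ℝ) ≤ 5 := by exact_mod_cast hsmall
      linarith
    calc z x₀ ≤ Real.sqrt S := single_le_sqrt_sum_sq hz hx₀
      _ = Real.sqrt ((2 * r + 1 : ℝ) ^ d) * Real.sqrt (((2 * r + 1 : ℝ) ^ d)⁻¹ * S) := hsplit
      _ ≤ Real.sqrt (11 ^ d) * Real.sqrt (((2 * r + 1 : ℝ) ^ d)⁻¹ * S) := mul_le_mul_of_nonneg_right h11 hnorm0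
      _ ≤ max (Real.sqrt (11 ^ d)) (K * Real.sqrt (21 ^ d)) * Real.sqrt (((2 * r + 1 : ℝ) ^ d)⁻¹ * S) :=
          mul_le_mul_of_nonneg_right (le_max_left _ _) hnorm0
  · push Not at hsmall
    set R : ℕ := (r - 1) / 5 with hR
    have hR1 : 1 ≤ R := by omega
    have hRr : R ≤ r := by omega
    have hroom : ∀ μ, 10 * R + 4 ≤ N μ := fun μ => by have := hr μ; omega
    have h21 : 2 * r + 1 ≤ 21 * R := by omega
    set BR := univ.filter (fun x : UT N => dist x x₀ ≤ R) with hBR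
    have hsubR : ∀ x, dist x x₀ ≤ R → 2 * d * z x ≤ ∑ μ, (z (up x μ) + z (dn x μ)) := fun x hx =>
      hsub x (hx.trans (by exact_mod_cast hRr))
    have hmain := h x₀ R hR1 hroom z hz hsubR
    have hsum : ∑ x ∈ BR, z x ^ 2 ≤ S := by
      refine Finset.sum_le_sum_of_subset_of_nonneg (fun x hx => ?_) fun x _ _ => sq_nonneg _
      rw [hBR, mem_filter] at hx
      rw [hBx, mem_filter]
      exact ⟨mem_univ _, hx.2.trans (by exact_mod_cast hRr)⟩
    have hR0 : (0 : ℝ) < (R : ℝ) ^ d := by positivity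
    have hinv : (((R : ℝ)) ^ d)⁻¹ ≤ (21 : ℝ) ^ d * (((2 * r + 1 : ℝ)) ^ d)⁻¹ := by
      have hle : (2 * r + 1 : ℝ) ^ d ≤ (21 * (R : ℝ)) ^ d :=
        pow_le_pow_left₀ (by positivity) (by exact_mod_cast h21) d
      rw [mul_pow] at hle
      calc (((R : ℝ)) ^ d)⁻¹ = (21 : ℝ) ^ d * ((21 : ℝ) ^ d * (R : ℝ) ^ d)⁻¹ := by field_simp
        _ ≤ (21 : ℝ) ^ d * (((2 * r + 1 : ℝ)) ^ d)⁻¹ := by gcongr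
    have hstep : Real.sqrt ((∑ x ∈ BR, z x ^ 2) / (R : ℝ) ^ d) ≤
        Real.sqrt (21 ^ d) * Real.sqrt (((2 * r + 1 : ℝ) ^ d)⁻¹ * S) := by
      rw [div_eq_inv_mul, ← Real.sqrt_mul (by positivity), ← mul_assoc]
      exact Real.sqrt_le_sqrt (mul_le_mul hinv hsum (Finset.sum_nonneg fun x _ => sq_nonneg _) (by positivity))
    calc z x₀ ≤ K * Real.sqrt ((∑ x ∈ BR, z x ^ 2) / (R : ℝ) ^ d) := hmain
      _ ≤ K * (Real.sqrt (21 ^ d) * Real.sqrt (((2 * r + 1 : ℝ) ^ d)⁻¹ * S)) := mul_le_mul_of_nonneg_left hstep hK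
      _ = K * Real.sqrt (21 ^ d) * Real.sqrt (((2 * r + 1 : ℝ) ^ d)⁻¹ * S) := by ring
      _ ≤ max (Real.sqrt (11 ^ d)) (K * Real.sqrt (21 ^ d)) * Real.sqrt (((2 * r + 1 : ℝ) ^ d)⁻¹ * S) :=
          mul_le_mul_of_nonneg_right (le_max_right _ _) hnorm0

/-! ## §2 THE BINDER (MV₂) DISCHARGED (beta-d4-p2's `meanValue_ball` + §1) -/

/-- **THE ℓ² MEAN-VALUE BINDER OF FILE 16d HOLDS** on the unit torus with a constant bond weight `c ≡ c₀ ≠ 0`: for every centre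
`x₀`, radius `r` with `2r + 2 ≤ N_μ`, and `z ≥ 0` with `2d·z(x) ≤ Σ_μ (z(x+e_μ) + z(x−e_μ))` on `dist(·,x₀) ≤ r`,
`z(x₀) ≤ C·√((2r+1)^{−d}·Σ_{dist(x,x₀) ≤ r} z(x)²)` with `C = max(√(11^d), C_d·√(21^d))`, `C_d = SubsolutionMeanValueBox.Cmv d` —
beta-d4-p2's `meanValue_ball` (lattice De Giorgi, kernel) through `l2binder_of_roomy10` and `wn_of_subharmonic`. [folklore] -/
theorem hMV2_holds [NeZero d] {c : UT N × Fin d → ℝ} {c₀ : ℝ} (hcc : ∀ b, c b = c₀) (hc₀ : c₀ ≠ 0) :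
    ∀ (x₀ : UT N) (r : ℕ), (∀ μ, 2 * r + 2 ≤ N μ) → ∀ z : UT N → ℝ, (∀ y, 0 ≤ z y) →
      (∀ x, dist x x₀ ≤ r → 2 * d * z x ≤ ∑ μ, (z (up x μ) + z (dn x μ))) →
      z x₀ ≤ max (Real.sqrt (11 ^ d)) (Cmv d * Real.sqrt (21 ^ d)) *
        Real.sqrt (((2 * r + 1 : ℝ) ^ d)⁻¹ * ∑ x ∈ univ.filter (fun x : UT N => dist x x₀ ≤ r), z x ^ 2) := by
  have hd1 : 1 ≤ d := Nat.one_le_iff_ne_zero.mpr (NeZero.ne d)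
  refine l2binder_of_roomy10 (Cmv_pos hd1).le fun x₀ R hR hN z hz hsub => ?_
  exact meanValue_ball hcc hc₀ x₀ hR hN z hz fun x hx => wn_of_subharmonic hcc (hsub x (mem_filter.mp hx).2)

/-! ## §3 O.2 ITEM (ii-b) CLOSED AT MODEL LEVEL: `hreg` and the sup member with NO binder left -/

variable [NeZero d] {Cp J K : Type} [Fintype Cp] [DecidableEq Cp] [Nonempty Cp]
  [Fintype J] [Fintype K] [DecidableEq K] (S : J → ℕ) (hS : ∀ l, 1 ≤ S l) (hdivS : ∀ l i, S l ∣ N i) (lvl : K → J)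
  (zc : (k : K) → Ctr N (S (lvl k)))
  (hdisj : ∀ k k' v v', cellPt S hS hdivS lvl zc k v = cellPt S hS hdivS lvl zc k' v' → k = k')
  (hcover : ∀ x : UT N, ∃ k, ∃ v : Box d (S (lvl k)), cellPt S hS hdivS lvl zc k v = x)
  (Rm : UT N × Fin d → Cp → Cp → ℝ) (hRm : ∀ b i j, ∑ k, Rm b k i * Rm b k j = if i = j then (1 : ℝ) else 0)
  (T : J → UT N → Cp → Cp → ℝ) (hT : ∀ l x i i', ∑ k, T l x k i * T l x k i' = if i = i' then (1 : ℝ) else 0)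
  (a : J → ℝ) (ha : ∀ j, 0 ≤ a j) (ω : J → UT N → ℝ)
  (hsupp : ∀ l x, ω l (ctrU N (S l) (tblk (hS l) (hdivS l) x)) ≠ 0 → ∃ k v, lvl k = l ∧ cellPt S hS hdivS lvl zc k v = x)
  {amax : ℝ} (hamax : 0 ≤ amax)
  (hscale : ∀ k, a (lvl k) * ω (lvl k) (ctrU N (S (lvl k)) (zc k)) ^ 2 * (S (lvl k) : ℝ) ^ d ≤ amax / (S (lvl k) : ℝ) ^ 2)
  (c : UT N × Fin d → ℝ) {c₀ : ℝ} (hcc : ∀ b, c b = c₀) (hc₀ : c₀ ≠ 0)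
  {L : ℕ} (hL : 1 ≤ L) (e : J → ℕ) (hSe : ∀ l, S l = L ^ e l) {R : ℝ} (hR : 0 < R) {A : ℕ}
  (hadd : ∀ x y : UT N, |(e (lvl (cellOf S hS hdivS lvl zc hcover x)) : ℝ) - e (lvl (cellOf S hS hdivS lvl zc hcover y))| ≤
    A + sdist bsrc btgt (siteScale S hS hdivS lvl zc hcover) x y / R)

include hdisj hT ha hsupp hamax hscale hL e hSe hR hadd hRm hcc hc₀

omit [Fintype K] in
/-- **FILE 9b's LOCAL-REGULARITY DATUM `hreg` FOR `levelOp` — HYPOTHESIS-FREE IN THE MODEL SETTING.**  Constant bond weight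
`c ≡ c₀ ≠ 0`, graded sides `S_l = L^{e_l}` (`1 ≤ L`, `0 < R`) with the sitewise additive datum, the (P) budget `hscale`;
`Γ = L^A·e^{(log L/R)(4d+1)}`, `θ = 1/(4dΓ)`, `C = max(√(11^d), C_d√(21^d))`: for every field `f`, site `p` and `m′`, if
`|(levelOp f)(q)| ≤ m′` whenever `d_n(q, p) ≤ 4d + 1`, then
`|f(p)| ≤ (C/√(θ^d) + √|Cp|·(θ+1)²·a_max·Γ²·√(Γ^d)/(2c₀²))·√(n(p)^{−d}·Σ_{d_n(q,p) ≤ 4d+1} f(q)²) + √|Cp|·(θ+1)²/(2c₀²)·n(p)²·m′`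
(16d `hreg_of_meanValueL2` with `hMV2_holds`). [cite: Balaban1985BackgroundPropagators, Thm 3.1 (3.42) p.397] [folklore] -/
theorem hreg_holds {Γ θ : ℝ} (hΓ : Γ = (L : ℝ) ^ A * Real.exp (Real.log L / R * (4 * d + 1)))
    (hθ : θ = 1 / (4 * d * Γ)) :
    ∀ (f : UT N × Cp → ℝ) (p : UT N × Cp) (m' : ℝ),
      (∀ q : UT N × Cp, sdist bsrc btgt (siteScale S hS hdivS lvl zc hcover) q.1 p.1 ≤ 4 * d + 1 →
        |levelOp bsrc btgt c Rm (fun l x => ctrU N (S l) (tblk (hS l) (hdivS l) x))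
          (fun l x => ω l (ctrU N (S l) (tblk (hS l) (hdivS l) x))) T a f q| ≤ m') →
      |f p| ≤ (max (Real.sqrt (11 ^ d)) (Cmv d * Real.sqrt (21 ^ d)) / Real.sqrt (θ ^ d) +
            Real.sqrt (Fintype.card Cp) * (θ + 1) ^ 2 * (amax * Γ ^ 2 * Real.sqrt (Γ ^ d)) / (2 * c₀ ^ 2)) *
          Real.sqrt (((siteScale S hS hdivS lvl zc hcover p.1 : ℝ) ^ d)⁻¹ *
            ∑ q ∈ univ.filter (fun q : UT N × Cp =>
              sdist bsrc btgt (siteScale S hS hdivS lvl zc hcover) q.1 p.1 ≤ 4 * d + 1), f q ^ 2) +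
        Real.sqrt (Fintype.card Cp) * (θ + 1) ^ 2 / (2 * c₀ ^ 2) * (siteScale S hS hdivS lvl zc hcover p.1 : ℝ) ^ 2 * m' := by
  have hC1 : 1 ≤ max (Real.sqrt (11 ^ d)) (Cmv d * Real.sqrt (21 ^ d)) :=
    le_max_of_le_left (by
      rw [show (1 : ℝ) = Real.sqrt 1 from Real.sqrt_one.symm]
      exact Real.sqrt_le_sqrt (one_le_pow₀ (by norm_num)))
  exact hreg_of_meanValueL2 S hS hdivS lvl zc hdisj hcover Rm hRm T hT a ha ω hsupp hamax hscale c hcc hc₀ hL e hSe hR hadd hΓ hθ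
    hC1 (hMV2_holds hcc hc₀)

/-- **THE SUP-NORM MEMBER (3.42)₁'s SHAPE FOR `levelOp`, SITEWISE, LEVEL-FREE — O.2 ITEM (ii-b) CLOSED AT MODEL LEVEL.**  In the
MODEL setting of `MultiscaleDecay.hc_levelOp` (coercivity `hcoer` with constant `C`, `|c_b| ≤ c_max`, `0 ≤ κ ≤ 1`, the margin
`μ₀ = C − 2d·c_max²κ² − a_max(e^{2dκ} − 1) > 0`) with a CONSTANT bond weight `c ≡ c₀ ≠ 0`, graded sides with the additive datum,
the (P) budget and the rate condition `(1 + d/2)(log L/R) ≤ κ`: for `u` supported in cell `k′` with `|u| ≤ m` and every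
`p = (x,i)`, `|((levelOp)⁻¹u)(p)| ≤ (c₁K₁ + c₂K₂)·n(x)²·e^{−(κ − (1+d/2)log L/R)·d_n(x,t_{k′})}·m` with
`c₁ = C_MV/√(θ^d) + √|Cp|(θ+1)²a_maxΓ²√(Γ^d)/(2c₀²)`, `c₂ = √|Cp|(θ+1)²/(2c₀²)`, `C_MV = max(√(11^d), C_d√(21^d))`,
`K₁ = √|Cp|·e^{κ(6d+1)}·Γ·L^A·√((L^A)^d)/μ₀`, `K₂ = e^{(κ − (1+d/2)log L/R)(6d+1)}` — constants seeing `d, c₀, c_max, a_max, C, κ, L,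
A, R, |Cp|` ONLY; NO binder, NO named fact.  File 9b BY NAME ∘ 16d ∘ `hMV2_holds` (beta-d4-p2's `meanValue_ball`).  NOT a bound on
Bałaban's G′(U): the MODEL only. [cite: Balaban1985BackgroundPropagators, Thm 3.1 (3.42) p.397; Balaban1984PropagatorsII, Prop. 2.2 (2.67) p.234] [folklore] -/
theorem real_sup_levelOp_inverse_le {cmax : ℝ} (hc : ∀ b, |c b| ≤ cmax) {C : ℝ}
    (hcoer : ∀ f : UT N × Cp → ℝ,
      C * ∑ k, ((S (lvl k) : ℝ) ^ 2)⁻¹ * ∑ v : Box d (S (lvl k)), ∑ i, f (cellPt S hS hdivS lvl zc k v, i) ^ 2 ≤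
        ∑ p, f p * levelOp bsrc btgt c Rm (fun l x => ctrU N (S l) (tblk (hS l) (hdivS l) x))
          (fun l x => ω l (ctrU N (S l) (tblk (hS l) (hdivS l) x))) T a f p)
    {κ : ℝ} (hκ0 : 0 ≤ κ) (hκ1 : κ ≤ 1) (hμ : 0 < C - 2 * d * cmax ^ 2 * κ ^ 2 - amax * (Real.exp (2 * d * κ) - 1))
    (hrate : (1 + d / 2) * (Real.log L / R) ≤ κ)
    {Γ θ : ℝ} (hΓ : Γ = (L : ℝ) ^ A * Real.exp (Real.log L / R * (4 * d + 1))) (hθ : θ = 1 / (4 * d * Γ))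
    (k' : K) (u : UT N × Cp → ℝ) (hu : ∀ p, cellOf S hS hdivS lvl zc hcover p.1 ≠ k' → u p = 0)
    {m : ℝ} (hm : 0 ≤ m) (hum : ∀ p, |u p| ≤ m) (p : UT N × Cp) :
    |(Ring.inverse (levelOp bsrc btgt c Rm (fun l x => ctrU N (S l) (tblk (hS l) (hdivS l) x))
        (fun l x => ω l (ctrU N (S l) (tblk (hS l) (hdivS l) x))) T a)) u p| ≤
      ((max (Real.sqrt (11 ^ d)) (Cmv d * Real.sqrt (21 ^ d)) / Real.sqrt (θ ^ d) +
            Real.sqrt (Fintype.card Cp) * (θ + 1) ^ 2 * (amax * Γ ^ 2 * Real.sqrt (Γ ^ d)) / (2 * c₀ ^ 2)) *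
          (Real.sqrt (Fintype.card Cp) * Real.exp (κ * ((4 * d + 1) + 2 * d)) *
            ((L : ℝ) ^ A * Real.exp (Real.log L / R * (4 * d + 1))) * (L : ℝ) ^ A * Real.sqrt (((L : ℝ) ^ A) ^ d) /
            (C - 2 * d * cmax ^ 2 * κ ^ 2 - amax * (Real.exp (2 * d * κ) - 1))) +
          Real.sqrt (Fintype.card Cp) * (θ + 1) ^ 2 / (2 * c₀ ^ 2) *
            Real.exp ((κ - (1 + d / 2) * (Real.log L / R)) * ((4 * d + 1) + 2 * d))) *
        (siteScale S hS hdivS lvl zc hcover p.1 : ℝ) ^ 2 *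
        Real.exp (-((κ - (1 + d / 2) * (Real.log L / R)) *
          sdist bsrc btgt (siteScale S hS hdivS lvl zc hcover) p.1 (ctrU N (S (lvl k')) (zc k')))) * m := by
  have hC1 : 1 ≤ max (Real.sqrt (11 ^ d)) (Cmv d * Real.sqrt (21 ^ d)) :=
    le_max_of_le_left (by
      rw [show (1 : ℝ) = Real.sqrt 1 from Real.sqrt_one.symm]
      exact Real.sqrt_le_sqrt (one_le_pow₀ (by norm_num)))
  exact real_sup_levelOp_inverse_le_of_meanValueL2 S hS hdivS lvl zc hdisj hcover Rm hRm T hT a ha ω hsupp hamax hscale c hcc hc₀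
    hL e hSe hR hadd hc hcoer hκ0 hκ1 hμ hrate hΓ hθ hC1 (hMV2_holds hcc hc₀) k' u hu hm hum p

end

end Summit.QuantumFields.BalabanUV.Beta.MultiscaleRegularityClosed
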